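import Summits.QuantumFields.YangMills.Theorems.CurvatureSandwichBound.Negative.ConstFieldOS
import Summits.QuantumFields.YangMills.Theorems.CurvatureBoostCovariance.Negative.BetaZeroTie
import Summits.QuantumFields.YangMills.Theorems.PencilRigidityNPointIsotropyRiemannSum

/-!
# `CurvatureSandwichBound` (Σ) — negative-side support V: a `β ≡ 0` scheme TIES the constant field; the
constant field is a certified NON-VACUUM inhabitant of the whole hypothesis set

Support file for crux `stmt-QuantumFields-18372` (refuter, cdisprove), extracted from the work file
`Cruxes/CurvatureSandwichBound/Disproof.lean`.  Tree objects only; nothing is posited.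

* `constScheme r κ`: the `β ≡ 0` scheme with `c_k ≡ κ` and additive counterterm `m_k ≡ 6 d₀ − 1`
  (`d₀ = haarTraceRe r.ρ`), so that `c_k (6 d₀ − m_k) = κ`; spacings / boxes as in `SpeciesScheme.zero`.
* `tie_constField`: lattice Yang–Mills at infinite coupling along `constScheme r κ` CONVERGES, on every off-diagonal
  real tensor of positive degree, to the constant field `𝔖ₙ(F) = κⁿ ∫F` (landed `latticeSchwinger_beta_zero` +
  Riemann sums of Schwartz functions, landed `tendsto_riemannSum_box`).
* `gaps_constField`, `W1_constField`, `hypotheses_constField`: for EVERY compact group `G` and every `r`, the pair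
  (`constScheme r κ`, `constField κ`) satisfies `W1`, the eight-frame RP, the planar cone AND the soft kernel — the
  first certified inhabitant of the common hypothesis set of Σ, B, B′ with NON-ZERO field vectors
  (`norm_fieldVec_constField`: `‖Ψ_F‖ = |κ|ⁿ|∫F|`); its OS space is still the vacuum line, and Σ holds on it
  (`conclusion_constField`, `μ = 0`).
(Support file VI, `SigmaSupFalse.lean`, uses this inhabitant to refute the crux-shaped sup-norm-only strengthening
of Σ unconditionally.)
-/

noncomputable section

namespace Summit.QuantumFields.YangMills.Theorems.CurvatureSandwichBound.Negative

open scoped BigOperators SchwartzMap ComplexConjugate InnerProductSpace ENNReal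
open MeasureTheory Filter Topology Complex
open Literature.MathematicalPhysics.QuantumLattice Literature.MathematicalPhysics.AQFT
  Literature.MathematicalPhysics.QuantumFieldTheory
open Literature.Probability.LatticeModels (box Site)
open Summit.QuantumFields.YangMills.Theorems.NPointIsotropy.Negative (E4)
open Summit.QuantumFields.YangMills.Theorems.CurvatureBoostCovariance.Negative
  (OSPackage Translations Hypercubic EightFrameRP PlanarCone Tie Gaps W1 haarTraceRe latticeSchwinger_beta_zero
    eventually_lt_side prod_eq_zero_of_not_injective)
open Summit.QuantumFields.YangMills.Theorems.SoftKernelBoostCovariance.Negative (SoftKernel)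
open Summit.QuantumFields.YangMills.Theorems.DiagonalMirrorRPR.Negative
  (constField constField_apply hasLatticeMassGap_of_beta_eq_zero)
open Summit.QuantumFields.YangMills.Theorems.NPointIsotropy.ComplexRotationBandlimit (tendsto_riemannSum_box)

section Scheme

variable {G : Type} [Group G] [TopologicalSpace G] [IsTopologicalGroup G] [CompactSpace G]
  [MeasurableSpace G] [BorelSpace G]

/-- **The constant-field scheme**: `β ≡ 0`, `c_k ≡ κ`, `m_k ≡ 6 d₀ − 1` (`d₀ = haarTraceRe r.ρ`); spacings
`a_k = 1/(k+1)` and half-sides `L_k = (k+1)²` as in the degenerate scheme. [folklore] -/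
def constScheme (r : LatticeRep G) (κ : ℝ) : SpeciesScheme (YMSpecies G) :=
  { SpeciesScheme.zero (YMSpecies G) with
    β := fun _ => 0
    c := fun _ _ => κ
    m := fun _ _ => 6 * haarTraceRe r.ρ - 1 }

/-- Its couplings vanish. [folklore] -/
@[simp] theorem constScheme_β (r : LatticeRep G) (κ : ℝ) (k : ℕ) : (constScheme r κ).β k = 0 := rfl

/-- Its multiplicative renormalisation is `κ`. [folklore] -/
@[simp] theorem constScheme_c (r : LatticeRep G) (κ : ℝ) (s : YMSpecies G) (k : ℕ) : (constScheme r κ).c s k = κ := rfl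

/-- Its additive counterterm is `6 d₀ − 1`. [folklore] -/
@[simp] theorem constScheme_m (r : LatticeRep G) (κ : ℝ) (s : YMSpecies G) (k : ℕ) :
    (constScheme r κ).m s k = 6 * haarTraceRe r.ρ - 1 := rfl

/-- **THE TIE: lattice Yang–Mills at `β ≡ 0` along `constScheme r κ` converges to the constant field `κ`** on
every off-diagonal real tensor of positive degree: for large `k` the lattice `n`-point function IS
`κⁿ ∏ᵢ a_k⁴ Σ_y fᵢ(a_k y)` (`latticeSchwinger_beta_zero`), and the Riemann sums converge to `∏ᵢ ∫ fᵢ = ∫ F`. [folklore] -/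
theorem tie_constField (r : LatticeRep G) (κ : ℝ) : Tie r (constScheme r κ) (constField κ) := by
  intro n hn f F hF hF'
  set sch := constScheme r κ with hsch
  have hlim : Tendsto (fun k => κ ^ n * ∏ i, (sch.a k ^ 4 * ∑ y ∈ box 4 (sch.L k), f i (sch.a k • siteToE y)))
      atTop (𝓝 (κ ^ n * ∏ i, ∫ x, f i x)) :=
    (tendsto_finsetProd Finset.univ fun i _ =>
      tendsto_riemannSum_box (f i) sch.a sch.L sch.a_pos sch.tendsto_a sch.tendsto_L).const_mul _
  have hev : ∀ᶠ k in atTop, latticeSchwinger r.ρ sch (fun s => s.F) k n (fun _ => r.curvature) f =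
      κ ^ n * ∏ i, (sch.a k ^ 4 * ∑ y ∈ box 4 (sch.L k), f i (sch.a k • siteToE y)) := by
    filter_upwards [eventually_lt_side sch n] with k hk
    rw [latticeSchwinger_beta_zero r sch k rfl hk f (fun Y _ hY => prod_eq_zero_of_not_injective hF hF' _ Y hY)]
    simp only [hsch, constScheme_c, constScheme_m]
    congr 1
    ring
  have hval : constField κ n F = ((κ ^ n * ∏ i, ∫ x, f i x : ℝ) : ℂ) := by
    rw [constField_apply]
    have hFx : (fun x : Fin n → E4 => F x) = fun x => ∏ i, (fun (i : Fin n) (y : E4) => (f i y : ℂ)) i (x i) := by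
      funext x
      rw [hF x]
      rfl
    have hprod := integral_fintype_prod_volume_eq_prod (𝕜 := ℂ) (fun (i : Fin n) (y : E4) => (f i y : ℂ))
    rw [hFx, hprod]
    push_cast
    congr 1
    refine Finset.prod_congr rfl fun i _ => ?_
    exact integral_complex_ofReal
  rw [hval]
  refine ((Complex.continuous_ofReal.tendsto _).comp hlim).congr' ?_
  filter_upwards [hev] with k hk
  simp only [Function.comp_apply, hk]

/-- **Both gaps**: the continuum clause with `Δ = 1` (constant `0`) and the uniform lattice gap at `β ≡ 0`
(landed `hasLatticeMassGap_of_beta_eq_zero`). [folklore] -/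
theorem gaps_constField (r : LatticeRep G) (κ : ℝ) : Gaps r (constScheme r κ) (constField κ) :=
  ⟨1, one_pos, hasMassGap_constField κ 1, hasLatticeMassGap_of_beta_eq_zero r _ (fun _ => rfl) 1⟩

/-- **`W1` for the constant field along its scheme** (tie, OS package, translations, hypercubic, gaps). [folklore] -/
theorem W1_constField (r : LatticeRep G) (κ : ℝ) : W1 r (constScheme r κ) (constField κ) :=
  ⟨tie_constField r κ, osPackage_constField κ, translations_constField κ, hypercubic_constField κ, gaps_constField r κ⟩

/-- **THE CONSTANT FIELD IS A CERTIFIED INHABITANT OF THE WHOLE HYPOTHESIS SET** of Σ (= of B′): `W1`, the eight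
frames, the planar cone, the soft kernel — for EVERY compact group `G`, every `r`, every `κ`; and both rows of the
conclusion hold on it (`μ = 0`).  Its field vectors are non-zero (`‖Ψ_F‖ = |κ|ⁿ|∫F|`) although its OS space is
the vacuum line. [folklore] -/
theorem hypotheses_constField (r : LatticeRep G) (κ : ℝ) :
    W1 r (constScheme r κ) (constField κ) ∧ EightFrameRP (constField κ) ∧ PlanarCone (constField κ) ∧
      SoftKernel (constField κ) ∧ SandwichRows (constField κ) ∧
        ∀ R : E4 ≃ₗᵢ[ℝ] E4, SandwichRows (fun n => (constField κ n).comp (linActMulti R)) :=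
  ⟨W1_constField r κ, eightFrameRP_constField κ, planarCone_constField κ, softKernel_constField κ,
    sandwichRows_constField κ, sandwichRows_constField_pullback κ⟩

end Scheme

end Summit.QuantumFields.YangMills.Theorems.CurvatureSandwichBound.Negative

end
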